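import Mathlib.Data.Int.Notation
import Mathlib.Data.Nat.Notation
import Mathlib.Data.List.Sublists
import Mathlib.Data.Fintype.Fin
import Mathlib.Data.Finset.Insert
import Mathlib.Data.Nat.Bitwise
import Mathlib.Data.Real.Basic
import Mathlib.Algebra.BigOperators.Group.List.Basic
import HarnessLib

/-!
# `NoHeavyLowerTail` (stmt-CriticalPhenomena-4575) — antithetic cluster pairs: the COMPUTABLE DATA of the shifted-BIC decision procedure
# (codes of coordinate sets and of monotone Boolean functions, the reduced form, the checker; prim-hp-2 gen 66, HOME/MEMO-gen66.md §1)

Support file (`--supports stmt-CriticalPhenomena-4575`, hull-port prover `prim-hp-2`, gen 66).  COMPUTABLE DEFINITIONS ONLY (their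
correctness and the decision theorem are …AntitheticShiftDecide); no named facts, no sorries; standard axioms.  See …AntitheticShiftDecide
for the reduction these objects implement.  For `m` free coordinates:
* `Antithetic.ShiftDecide.enc S` — binary code of `S : Finset (Fin m)` (bit `i` ↔ `i ∈ S`; an or-fold: all bit lemmas are `Nat.testBit_or`,
  no carries); `subsets m` — all coordinate sets as a list; `encodeFun φ` — code `< 2^(2^m)` of a Boolean function on the coordinate sets
  (bit `enc S` ↔ `φ S`); `monoPairs`, `isMonoWith`, `monoList m` — ALL monotone Boolean functions on `2^[m]` as codes (168 for `m = 4`);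
* `bitz` / `bitr` — bit values in `ℤ` / `ℝ`; `Qcode h F G F' G' = Σ_{(x,y,c) ∈ h} c · (F(x) − G(y)) · (F'(x) − G'(y))` — the reduced
  shifted-BIC form on a histogram `h` of code pairs; `T1`, `T2`, `T4` — its partial forms; `histMultiset h` — the multiset a histogram describes;
* `pairList`, `checkCore`, `check m h` — the checker: monotone codes → four tables → double loop over nested index pairs `ia ≤ ib`
  (≈ 2.9·10⁷ look-ups for `m = 4`, ≈ 40 s of `native_decide`).
[cite: VandenbergHaggstromKahn2005, §1 p. 6 ("Harris' inequality")]
-/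

namespace Summit.CriticalPhenomena.PercolationContinuityZ3.Theorems

namespace Antithetic

namespace ShiftDecide

variable {m : ℕ}

/-- Binary code of a set of coordinates: bit `i` is set iff `i ∈ S`. [this work] -/
def enc (S : Finset (Fin m)) : ℕ := ((List.finRange m).filter (· ∈ S)).foldr (fun (i : Fin m) (acc : ℕ) => 2 ^ i.val ||| acc) 0

/-- All coordinate sets, as a list. [this work] -/
def subsets (m : ℕ) : List (Finset (Fin m)) := (List.finRange m).sublists.map List.toFinset

/-- Code of a Boolean function on the coordinate sets: bit `enc S` is set iff `φ S`. [this work] -/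
def encodeFun (φ : Finset (Fin m) → Bool) : ℕ :=
  (subsets m).foldr (fun S acc => if φ S then 2 ^ (enc S) ||| acc else acc) 0

/-- The (code of set, code of set with one more coordinate) pairs along which monotonicity is tested. [this work] -/
def monoPairs (m : ℕ) : List (ℕ × ℕ) := (subsets m).flatMap fun S => (List.finRange m).map fun i => (enc S, enc (insert i S))

/-- Monotonicity test of a function code along the pairs `mp`. [this work] -/
def isMonoWith (mp : List (ℕ × ℕ)) (F : ℕ) : Bool := mp.all fun e => !(F.testBit e.1) || F.testBit e.2

/-- All MONOTONE Boolean functions on the coordinate sets, as codes `< 2^(2^m)`. [this work] -/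
def monoList (m : ℕ) : List ℕ := (List.range (2 ^ (2 ^ m))).filter (isMonoWith (monoPairs m))

/-- Integer value of bit `r` of the code `F`. [this work] -/
def bitz (F r : ℕ) : ℤ := if F.testBit r then 1 else 0

/-- The reduced shifted-BIC form on a histogram `h` of points `(x, y, c)` (codes of the red / blue coordinate sets, multiplicity):
`Σ c · (F(x) − G(y)) · (F'(x) − G'(y))`. [this work] -/
def Qcode (h : List (ℕ × ℕ × ℕ)) (F G F' G' : ℕ) : ℤ :=
  (h.map fun e => (e.2.2 : ℤ) * ((bitz F e.1 - bitz G e.2.1) * (bitz F' e.1 - bitz G' e.2.1))).sum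

/-- Partial form `Σ c · F(x) F'(x)`. [this work] -/
def T1 (h : List (ℕ × ℕ × ℕ)) (F F' : ℕ) : ℤ := (h.map fun e => (e.2.2 : ℤ) * (bitz F e.1 * bitz F' e.1)).sum
/-- Partial form `Σ c · F(x) G(y)`. -/
def T2 (h : List (ℕ × ℕ × ℕ)) (F G : ℕ) : ℤ := (h.map fun e => (e.2.2 : ℤ) * (bitz F e.1 * bitz G e.2.1)).sum
/-- Partial form `Σ c · G(y) G'(y)`. -/
def T4 (h : List (ℕ × ℕ × ℕ)) (G G' : ℕ) : ℤ := (h.map fun e => (e.2.2 : ℤ) * (bitz G e.2.1 * bitz G' e.2.1)).sum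

/-- The index pairs `(i, j)` of nested monotone codes `mono[j] ⊆ mono[i]` (bitwise). [this work] -/
def pairList (mono : Array ℕ) : List (ℕ × ℕ) :=
  (List.range mono.size).flatMap fun i =>
    ((List.range mono.size).filter fun j => (mono.getD j 0 &&& mono.getD i 0) == mono.getD j 0).map fun j => (i, j)

/-- The double loop of the checker over index pairs `ia ≤ ib`, with row tables. [this work] -/
def checkCore (t1 t2 t3 t4 : Array (Array ℤ)) (pairs : Array (ℕ × ℕ)) : Bool :=
  (List.range pairs.size).all fun ia =>
    let a := pairs.getD ia (0, 0)
    let r1 := t1.getD a.1 #[]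
    let r2 := t2.getD a.1 #[]
    let r3 := t3.getD a.2 #[]
    let r4 := t4.getD a.2 #[]
    pairs.all (fun b => decide (r2.getD b.2 0 + r3.getD b.1 0 ≤ r1.getD b.1 0 + r4.getD b.2 0)) ia

/-- **The checker**: all monotone codes, the four partial-form tables, and the double loop over nested pairs. [this work] -/
def check (m : ℕ) (h : List (ℕ × ℕ × ℕ)) : Bool :=
  let mono : Array ℕ := (monoList m).toArray
  let t1 : Array (Array ℤ) := mono.map fun F => mono.map fun F' => T1 h F F'
  let t2 : Array (Array ℤ) := mono.map fun F => mono.map fun G => T2 h F G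
  let t3 : Array (Array ℤ) := mono.map fun G => mono.map fun F' => T2 h F' G
  let t4 : Array (Array ℤ) := mono.map fun G => mono.map fun G' => T4 h G G'
  let pairs : Array (ℕ × ℕ) := (pairList mono).toArray
  checkCore t1 t2 t3 t4 pairs

/-- Real value of bit `r` of the code `F`. [this work] -/
def bitr (F r : ℕ) : ℝ := if F.testBit r then 1 else 0

/-- The multiset of code pairs described by a histogram. [this work] -/
def histMultiset (h : List (ℕ × ℕ × ℕ)) : Multiset (ℕ × ℕ) := (h.map fun e => Multiset.replicate e.2.2 (e.1, e.2.1)).sum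

end ShiftDecide

end Antithetic

end Summit.CriticalPhenomena.PercolationContinuityZ3.Theorems
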